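import Summits.AtomisticToContinuum.HydrodynamicLimit.Theorems.AntiMazurCoboundariesCellForecastPressureDecayContactLayerBounds
import Summits.AtomisticToContinuum.HydrodynamicLimit.Theorems.AntiMazurCoboundariesCellForecastPressureDecayCellLawFactorises
import HarnessLib

/-!
# S2c(D) · the ghost-sphere representation of the near-contact pair law
# (fourth file of stub `stub_contactStatistics`, crux line `enskog-compensator-martingale`,
# crux `CellForecastPressureDecay`, stmt-AtomisticToContinuum-13915)

The law of the relative position `x₁ − x₀` of two labelled sphere centres under the uniform hard-core position law
`posLaw σ L (m+2)` of the cell `[0,L]³` has a density proportional to the **fitting probability of a ghost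
sphere**: deleting the sphere `0` leaves `m + 1` spheres with law `posLaw σ L (m+1)`, and the density at `q` is
`Z_{m+1}/Z_{m+2}` times the probability `F(q)` that a ghost centre placed at `y₀ − q` (relative position `q` seen
from the sphere `y₀`) lies in the cube and at distance `≥ σ` from every centre:

* § 1 `insertGhost_mem_posAdmissible_iff` — the configuration `(y₀ − q, y)` is admissible iff `y` is and the
  ghost fits;
* § 2 `map_pairDiff_restrict_posAdmissible` — the **measure identity**
  `(vol|adm_{m+2}) ∘ (x ↦ x₁ − x₀)⁻¹ = vol.withDensity (q ↦ vol{y | (y₀ − q, y) ∈ adm_{m+2}})` (Tonelli, and the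
  shear `a ↦ y₀ − a`), hence `∫ ψ(x₁ − x₀) dposLaw_{m+2} = (Z_{m+1}/Z_{m+2}) ∫ ψ(q) F(q) dq` for every bounded
  measurable `ψ` (`integral_pairDiff_posLaw`);
* § 3 **mass bounds**: `Z_{m+1} (L³ − (m+1)·(4π/3)σ³) ≤ Z_{m+2} ≤ Z_{m+1} L³` (the free volume left to the ghost),
  so `Z_{m+1}/Z_{m+2} ∈ [L⁻³, 2L⁻³]` in the regime of the line;
* § 4 the registered sub-goal `stub_contactStatistics_ghost`.

This is the first, elementary half of the reduction of `ContactStatistics` (near-constancy of the pair density on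
thin contact shells) to the weak isotropy of the pair law; the companion reduction file moves the ghost (radial
near-constancy of `F` by the Ruelle bound) and averages over rotations, and the isotropy itself is the cluster
expansion (expansion, tree-bound and tail files of the stub).

References: D. Ruelle, *Statistical Mechanics: Rigorous Results* (1969), §4.2 (insertion of a particle in the
canonical hard-core gas); J.-P. Hansen, I. R. McDonald, *Theory of Simple Liquids* (2013), §2.5 (the pair
distribution at contact as an insertion probability).
-/

noncomputable section

open MeasureTheory ProbabilityTheory Set Filter
open scoped ENNReal BigOperators InnerProductSpace
open Literature.Analysis.FluidPDE Literature.MathematicalPhysics.KineticTheory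
open Literature.MathematicalPhysics.StatisticalMechanics
open Summit.AtomisticToContinuum.HydrodynamicLimit.Theorems.CellForecastPressureDecay
  (cellCube measurableSet_cellCube volume_cellCube abs_apply_sub_apply_le)

namespace Summit.AtomisticToContinuum.HydrodynamicLimit.Theorems.EnskogCompensator

/-! ## § 1 Inserting the ghost -/

/-- **Inserting the ghost**: the configuration `(y₀ − q, y₁, …)` of `m + 2` centres (ghost at label `0`, relative
position `q` of the host `y₀`) is admissible iff `y` is admissible, the ghost is in the cube and every centre of `y`
is at distance `≥ σ` from it. [folklore] -/
theorem insertGhost_mem_posAdmissible_iff (σ L : ℝ) {m : ℕ} (y : Fin (m + 1) → V3) (q : V3) :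
    Fin.cons (y 0 - q) y ∈ posAdmissible σ L (m + 2) ↔
      y ∈ posAdmissible σ L (m + 1) ∧ (∀ c, (y 0 - q) c ∈ Set.Icc (0 : ℝ) L) ∧
        ∀ k, σ ≤ ‖y k - (y 0 - q)‖ := by
  set x : Fin (m + 2) → V3 := Fin.cons (y 0 - q) y with hx
  have hx0 : x 0 = y 0 - q := rfl
  have hxs : ∀ k : Fin (m + 1), x k.succ = y k := fun k => by simp [hx]
  rw [mem_posAdmissible, mem_posAdmissible]
  constructor
  · rintro ⟨h1, h2⟩
    refine ⟨⟨fun k l hkl => ?_, fun k c => ?_⟩, fun c => ?_, fun k => ?_⟩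
    · have := h1 k.succ l.succ fun h => hkl (Fin.succ_injective _ h)
      rwa [hxs, hxs] at this
    · have := h2 k.succ c; rwa [hxs] at this
    · exact h2 0 c
    · have := h1 k.succ 0 (Fin.succ_ne_zero k)
      rwa [hxs, hx0] at this
  · rintro ⟨⟨hyy, hy⟩, hq, hk⟩
    refine ⟨fun i j hij => ?_, fun i c => ?_⟩
    · rcases Fin.eq_zero_or_eq_succ i with rfl | ⟨k, rfl⟩ <;>
        rcases Fin.eq_zero_or_eq_succ j with rfl | ⟨l, rfl⟩
      · exact (hij rfl).elim
      · rw [hx0, hxs, norm_sub_rev]; exact hk l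
      · rw [hx0, hxs]; exact hk k
      · rw [hxs, hxs]; exact hyy k l fun h => hij (by rw [h])
    · rcases Fin.eq_zero_or_eq_succ i with rfl | ⟨k, rfl⟩
      · rw [hx0]; exact hq c
      · rw [hxs]; exact hy k c

/-! ## § 2 The measure identity and the integral representation -/

/-- Splitting off the coordinate `0` and consing it back. [folklore] -/
theorem piFinSuccAbove_zero_symm_apply {m : ℕ} (a : V3) (y : Fin (m + 1) → V3) :
    (MeasurableEquiv.piFinSuccAbove (fun _ : Fin (m + 2) => V3) 0).symm (a, y) = Fin.cons a y := by
  simp [MeasurableEquiv.piFinSuccAbove, Fin.insertNthEquiv, Fin.insertNth_zero']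

/-- Measurability of `(q, y) ↦ (y₀ − q, y)`. [folklore] -/
theorem measurable_insertGhost (m : ℕ) :
    Measurable fun p : V3 × (Fin (m + 1) → V3) => (Fin.cons (p.2 0 - p.1) p.2 : Fin (m + 2) → V3) := by
  have : (fun p : V3 × (Fin (m + 1) → V3) => (Fin.cons (p.2 0 - p.1) p.2 : Fin (m + 2) → V3)) =
      fun p => (MeasurableEquiv.piFinSuccAbove (fun _ : Fin (m + 2) => V3) 0).symm (p.2 0 - p.1, p.2) := by
    funext p; rw [piFinSuccAbove_zero_symm_apply]
  rw [this]
  have h1 : Measurable fun p : V3 × (Fin (m + 1) → V3) => p.2 0 - p.1 :=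
    ((measurable_pi_apply 0).comp measurable_snd).sub measurable_fst
  exact (MeasurableEquiv.measurable _).comp (h1.prodMk measurable_snd)

/-- The ghost-fitting set `{y | (y₀ − q, y) ∈ adm}` is jointly measurable in `(q, y)`. [folklore] -/
theorem measurableSet_insertGhost (σ L : ℝ) (m : ℕ) :
    MeasurableSet {p : V3 × (Fin (m + 1) → V3) | Fin.cons (p.2 0 - p.1) p.2 ∈ posAdmissible σ L (m + 2)} :=
  measurable_insertGhost m (measurableSet_posAdmissible σ L (m + 2))

/-- The ghost-fitting set at fixed `q` is measurable. [folklore] -/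
theorem measurableSet_insertGhost_left (σ L : ℝ) (m : ℕ) (q : V3) :
    MeasurableSet {y : Fin (m + 1) → V3 | Fin.cons (y 0 - q) y ∈ posAdmissible σ L (m + 2)} :=
  measurable_prodMk_left (measurableSet_insertGhost σ L m)

/-- `q ↦ vol{y | (y₀ − q, y) ∈ adm}` is measurable. [folklore] -/
theorem measurable_volume_insertGhost (σ L : ℝ) (m : ℕ) :
    Measurable fun q : V3 =>
      volume {y : Fin (m + 1) → V3 | Fin.cons (y 0 - q) y ∈ posAdmissible σ L (m + 2)} :=
  measurable_measure_prodMk_left (measurableSet_insertGhost σ L m)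

/-- **The measure identity.** The image of Lebesgue measure restricted to the admissible set of `m + 2` centres
under the relative position `x ↦ x₁ − x₀` has density `q ↦ vol{y | (y₀ − q, y) ∈ adm_{m+2}}`: split off the
coordinate `x₀` (Tonelli) and shear it to the relative position `q = x₁ − x₀` (`a ↦ y₀ − a` preserves Lebesgue
measure). [folklore] -/
theorem map_pairDiff_restrict_posAdmissible (σ L : ℝ) (m : ℕ) :
    (volume.restrict (posAdmissible σ L (m + 2))).map (fun x : Fin (m + 2) → V3 => x 1 - x 0) =
      volume.withDensity
        (fun q : V3 => volume {y : Fin (m + 1) → V3 | Fin.cons (y 0 - q) y ∈ posAdmissible σ L (m + 2)}) := by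
  set adm := posAdmissible σ L (m + 2) with hadm_def
  have hadm : MeasurableSet adm := measurableSet_posAdmissible σ L (m + 2)
  set e := MeasurableEquiv.piFinSuccAbove (fun _ : Fin (m + 2) => V3) 0 with he
  have hπ : Measurable fun x : Fin (m + 2) → V3 => x 1 - x 0 :=
    (measurable_pi_apply 1).sub (measurable_pi_apply 0)
  have hS := measurableSet_insertGhost σ L m
  ext A hA
  rw [Measure.map_apply hπ hA, Measure.restrict_apply (hπ hA), withDensity_apply _ hA,
    ← lintegral_indicator_one ((hπ hA).inter hadm),
    ← ((volume_preserving_piFinSuccAbove (fun _ : Fin (m + 2) => V3) 0).symm e).lintegral_comp_emb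
      e.symm.measurableEmbedding, Measure.volume_eq_prod]
  have hF : Measurable fun p : V3 × (Fin (m + 1) → V3) =>
      ((fun x : Fin (m + 2) → V3 => x 1 - x 0) ⁻¹' A ∩ adm).indicator (1 : (Fin (m + 2) → V3) → ℝ≥0∞) (e.symm p) :=
    (measurable_one.indicator ((hπ hA).inter hadm)).comp e.symm.measurable
  rw [lintegral_prod_symm _ hF.aemeasurable]
  -- the inner integral: shear `a = y₀ − q`
  have hinner : ∀ y : Fin (m + 1) → V3,
      ∫⁻ a, ((fun x : Fin (m + 2) → V3 => x 1 - x 0) ⁻¹' A ∩ adm).indicator (1 : (Fin (m + 2) → V3) → ℝ≥0∞)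
          (e.symm (a, y)) =
        ∫⁻ q, A.indicator (1 : V3 → ℝ≥0∞) q *
          {p : V3 × (Fin (m + 1) → V3) | Fin.cons (p.2 0 - p.1) p.2 ∈ adm}.indicator 1 (q, y) := by
    intro y
    rw [← lintegral_sub_left_eq_self _ (y 0)]
    refine lintegral_congr fun q => ?_
    rw [he, piFinSuccAbove_zero_symm_apply]
    have h1 : (Fin.cons (y 0 - q) y : Fin (m + 2) → V3) 1 - (Fin.cons (y 0 - q) y : Fin (m + 2) → V3) 0 = q := by
      have : (Fin.cons (y 0 - q) y : Fin (m + 2) → V3) 1 = y 0 := rfl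
      rw [this, Fin.cons_zero, sub_sub_cancel]
    by_cases hq : q ∈ A <;> by_cases hy : (Fin.cons (y 0 - q) y : Fin (m + 2) → V3) ∈ adm
    · rw [Set.indicator_of_mem, Set.indicator_of_mem hq, Set.indicator_of_mem]
      · simp
      · exact hy
      · exact ⟨by rw [Set.mem_preimage, h1]; exact hq, hy⟩
    · rw [Set.indicator_of_notMem, Set.indicator_of_notMem (s := {p : V3 × (Fin (m + 1) → V3) | _})]
      · simp
      · exact hy
      · exact fun h => hy h.2
    · rw [Set.indicator_of_notMem, Set.indicator_of_notMem hq]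
      · simp
      · exact fun h => hq (by have := h.1; rwa [Set.mem_preimage, h1] at this)
    · rw [Set.indicator_of_notMem, Set.indicator_of_notMem hq]
      · simp
      · exact fun h => hy h.2
  simp_rw [hinner]
  have hG : Measurable fun p : V3 × (Fin (m + 1) → V3) => A.indicator (1 : V3 → ℝ≥0∞) p.1 *
      {p : V3 × (Fin (m + 1) → V3) | Fin.cons (p.2 0 - p.1) p.2 ∈ adm}.indicator 1 (p.1, p.2) :=
    ((measurable_one.indicator hA).comp measurable_fst).mul (measurable_one.indicator hS)
  rw [lintegral_lintegral_swap (f := fun y q => A.indicator (1 : V3 → ℝ≥0∞) q *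
      {p : V3 × (Fin (m + 1) → V3) | Fin.cons (p.2 0 - p.1) p.2 ∈ adm}.indicator 1 (q, y))
      ((hG.comp measurable_swap).aemeasurable), ← lintegral_indicator hA]
  refine lintegral_congr fun q => ?_
  have hm : Measurable fun y : Fin (m + 1) → V3 =>
      {p : V3 × (Fin (m + 1) → V3) | Fin.cons (p.2 0 - p.1) p.2 ∈ adm}.indicator
        (1 : V3 × (Fin (m + 1) → V3) → ℝ≥0∞) (q, y) :=
    (measurable_one.indicator hS).comp measurable_prodMk_left
  rw [lintegral_const_mul _ hm]
  have h2 : ∫⁻ y, {p : V3 × (Fin (m + 1) → V3) | Fin.cons (p.2 0 - p.1) p.2 ∈ adm}.indicator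
      (1 : V3 × (Fin (m + 1) → V3) → ℝ≥0∞) (q, y) = volume {y : Fin (m + 1) → V3 | Fin.cons (y 0 - q) y ∈ adm} := by
    rw [← lintegral_indicator_one (measurableSet_insertGhost_left σ L m q)]
    rfl
  rw [h2]
  by_cases hq : q ∈ A
  · rw [Set.indicator_of_mem hq, Set.indicator_of_mem hq]; simp
  · rw [Set.indicator_of_notMem hq, Set.indicator_of_notMem hq]; simp

/-- The admissible set sits in the box, so the positional partition function is finite. [folklore] -/
theorem posZ_lt_top (σ L : ℝ) (n : ℕ) : posZ σ L n < ⊤ := by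
  rw [posZ, posAdmissible_eq_pi_inter_hardCore]
  refine (measure_mono Set.inter_subset_left).trans_lt ?_
  rw [volume_pi_pi]
  exact ENNReal.prod_lt_top fun _ _ => by rw [volume_cellCube]; exact ENNReal.pow_lt_top ENNReal.ofReal_lt_top

/-- The position law is a probability measure as soon as the admissible set is not null. [folklore] -/
theorem isProbabilityMeasure_posLaw {σ L : ℝ} {n : ℕ} (h0 : posZ σ L n ≠ 0) :
    IsProbabilityMeasure (posLaw σ L n) :=
  ⟨by rw [posLaw, Measure.smul_apply, Measure.restrict_apply_univ, smul_eq_mul]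
      exact ENNReal.inv_mul_cancel h0 (posZ_lt_top σ L n).ne⟩

/-- The ghost-fitting set lies in the admissible set of the `m + 1` real centres. [folklore] -/
theorem insertGhost_subset_posAdmissible (σ L : ℝ) (m : ℕ) (q : V3) :
    {y : Fin (m + 1) → V3 | Fin.cons (y 0 - q) y ∈ posAdmissible σ L (m + 2)} ⊆ posAdmissible σ L (m + 1) :=
  fun y hy => ((insertGhost_mem_posAdmissible_iff σ L y q).1 hy).1

/-- `vol{y | (y₀ − q, y) ∈ adm_{m+2}} = Z_{m+1} · posLaw_{m+1}{ghost fits}`. [folklore] -/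
theorem volume_insertGhost_eq (σ L : ℝ) (m : ℕ) (h0 : posZ σ L (m + 1) ≠ 0) (q : V3) :
    volume {y : Fin (m + 1) → V3 | Fin.cons (y 0 - q) y ∈ posAdmissible σ L (m + 2)} =
      posZ σ L (m + 1) * posLaw σ L (m + 1) {y | Fin.cons (y 0 - q) y ∈ posAdmissible σ L (m + 2)} := by
  rw [posLaw, Measure.smul_apply, Measure.restrict_apply (measurableSet_insertGhost_left σ L m q), smul_eq_mul,
    Set.inter_eq_left.2 (insertGhost_subset_posAdmissible σ L m q), ← mul_assoc,
    ENNReal.mul_inv_cancel h0 (posZ_lt_top σ L (m + 1)).ne, one_mul]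

/-- The ghost-fitting volume is at most `Z_{m+1}`. [folklore] -/
theorem volume_insertGhost_le (σ L : ℝ) (m : ℕ) (q : V3) :
    volume {y : Fin (m + 1) → V3 | Fin.cons (y 0 - q) y ∈ posAdmissible σ L (m + 2)} ≤ posZ σ L (m + 1) :=
  measure_mono (insertGhost_subset_posAdmissible σ L m q)

/-- **The integral representation**: for every measurable `ψ`,
`∫ ψ(x₁ − x₀) dposLaw_{m+2} = (Z_{m+1}/Z_{m+2}) ∫ ψ(q) F(q) dq`, `F(q)` the probability under `posLaw_{m+1}` that the
ghost at relative position `q` from the centre `0` fits. [folklore] -/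
theorem integral_pairDiff_posLaw (σ L : ℝ) (m : ℕ) (h0 : posZ σ L (m + 1) ≠ 0) {ψ : V3 → ℝ}
    (hψ : Measurable ψ) :
    ∫ x, ψ (x 1 - x 0) ∂(posLaw σ L (m + 2)) =
      ((posZ σ L (m + 2))⁻¹ * posZ σ L (m + 1)).toReal *
        ∫ q, ψ q * (posLaw σ L (m + 1)).real {y | Fin.cons (y 0 - q) y ∈ posAdmissible σ L (m + 2)} := by
  have hπ : Measurable fun x : Fin (m + 2) → V3 => x 1 - x 0 :=
    (measurable_pi_apply 1).sub (measurable_pi_apply 0)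
  rw [posLaw_eq σ L (m + 2), integral_smul_measure, ← integral_map hπ.aemeasurable hψ.aestronglyMeasurable,
    map_pairDiff_restrict_posAdmissible, integral_withDensity_eq_integral_toReal_smul
      (measurable_volume_insertGhost σ L m) (Eventually.of_forall fun q =>
        (volume_insertGhost_le σ L m q).trans_lt (posZ_lt_top σ L (m + 1)))]
  have hfun : (fun q : V3 => (volume {y : Fin (m + 1) → V3 |
      Fin.cons (y 0 - q) y ∈ posAdmissible σ L (m + 2)}).toReal • ψ q) = fun q =>
        (posZ σ L (m + 1)).toReal *
          (ψ q * (posLaw σ L (m + 1)).real {y | Fin.cons (y 0 - q) y ∈ posAdmissible σ L (m + 2)}) := by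
    funext q
    rw [volume_insertGhost_eq σ L m h0 q, ENNReal.toReal_mul, smul_eq_mul, measureReal_def]
    ring
  rw [hfun, integral_const_mul, ENNReal.toReal_mul, smul_eq_mul]
  ring

/-! ## § 3 Mass bounds: the free volume left to the ghost -/

/-- `Z_{m+2} = ∫ vol{q | (y₀ − q, y) ∈ adm_{m+2}} dy` (the ghost integrated out last). [folklore] -/
theorem posZ_succ_eq_lintegral (σ L : ℝ) (m : ℕ) :
    posZ σ L (m + 2) =
      ∫⁻ y : Fin (m + 1) → V3, volume {q : V3 | Fin.cons (y 0 - q) y ∈ posAdmissible σ L (m + 2)} := by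
  have hπ : Measurable fun x : Fin (m + 2) → V3 => x 1 - x 0 :=
    (measurable_pi_apply 1).sub (measurable_pi_apply 0)
  have h1 : posZ σ L (m + 2) =
      (volume.restrict (posAdmissible σ L (m + 2))).map (fun x : Fin (m + 2) → V3 => x 1 - x 0) univ := by
    rw [Measure.map_apply hπ MeasurableSet.univ, Set.preimage_univ, Measure.restrict_apply_univ, posZ]
  have hS := measurableSet_insertGhost σ L m
  rw [h1, map_pairDiff_restrict_posAdmissible, withDensity_apply _ MeasurableSet.univ, Measure.restrict_univ]
  calc ∫⁻ q, volume {y : Fin (m + 1) → V3 | Fin.cons (y 0 - q) y ∈ posAdmissible σ L (m + 2)}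
      = ∫⁻ q : V3, volume (Prod.mk q ⁻¹'
          {p : V3 × (Fin (m + 1) → V3) | Fin.cons (p.2 0 - p.1) p.2 ∈ posAdmissible σ L (m + 2)}) := rfl
    _ = (volume.prod volume) {p : V3 × (Fin (m + 1) → V3) | Fin.cons (p.2 0 - p.1) p.2 ∈ posAdmissible σ L (m + 2)} :=
        (Measure.prod_apply hS).symm
    _ = ∫⁻ y : Fin (m + 1) → V3, volume ((fun q : V3 => (q, y)) ⁻¹'
          {p : V3 × (Fin (m + 1) → V3) | Fin.cons (p.2 0 - p.1) p.2 ∈ posAdmissible σ L (m + 2)}) :=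
        Measure.prod_apply_symm hS
    _ = _ := rfl

/-- For an admissible `y`, the ghost positions that fit are the translate by `y₀` of the free region
`{z ∈ [0,L]³ | ‖y_k − z‖ ≥ σ ∀ k}`, whose volume is between `L³ − (m+1)·vol B(0,σ)` and `L³`. [folklore] -/
theorem volume_ghostFits_bounds (σ L : ℝ) {m : ℕ} {y : Fin (m + 1) → V3} (hy : y ∈ posAdmissible σ L (m + 1)) :
    volume (cellCube L) - (m + 1 : ℕ) * volume (Metric.ball (0 : V3) σ) ≤
        volume {q : V3 | Fin.cons (y 0 - q) y ∈ posAdmissible σ L (m + 2)} ∧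
      volume {q : V3 | Fin.cons (y 0 - q) y ∈ posAdmissible σ L (m + 2)} ≤ volume (cellCube L) := by
  set G : Set V3 := {z | (∀ c, z c ∈ Set.Icc (0 : ℝ) L) ∧ ∀ k, σ ≤ ‖y k - z‖} with hG
  have hset : {q : V3 | Fin.cons (y 0 - q) y ∈ posAdmissible σ L (m + 2)} = (fun q => y 0 - q) ⁻¹' G := by
    ext q
    simp only [Set.mem_setOf_eq, insertGhost_mem_posAdmissible_iff, hy, true_and, Set.mem_preimage, hG]
  have hGm : MeasurableSet G := by
    have h1 : MeasurableSet {z : V3 | ∀ c, z c ∈ Set.Icc (0 : ℝ) L} := measurableSet_cellCube L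
    have h2 : MeasurableSet {z : V3 | ∀ k, σ ≤ ‖y k - z‖} := by
      have : {z : V3 | ∀ k, σ ≤ ‖y k - z‖} = ⋂ k, {z | σ ≤ ‖y k - z‖} := by ext; simp
      rw [this]
      exact MeasurableSet.iInter fun k => measurableSet_le measurable_const (measurable_const.sub measurable_id).norm
    simpa [hG, Set.setOf_and] using h1.inter h2
  have hvol : volume {q : V3 | Fin.cons (y 0 - q) y ∈ posAdmissible σ L (m + 2)} = volume G := by
    rw [hset]
    exact (Measure.measurePreserving_sub_left volume (y 0)).measure_preimage hGm.nullMeasurableSet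
  rw [hvol]
  constructor
  · -- the cube is covered by `G` and the `m + 1` excluded balls
    have hcover : cellCube L ⊆ G ∪ ⋃ k, Metric.ball (y k) σ := by
      intro z hz
      by_cases h : ∀ k, σ ≤ ‖y k - z‖
      · exact Or.inl ⟨hz, h⟩
      · push Not at h
        obtain ⟨k, hk⟩ := h
        exact Or.inr (Set.mem_iUnion.2 ⟨k, by rwa [Metric.mem_ball, dist_eq_norm, ← norm_sub_rev]⟩)
    have hballs : volume (⋃ k, Metric.ball (y k) σ) ≤ (m + 1 : ℕ) * volume (Metric.ball (0 : V3) σ) := by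
      refine (measure_iUnion_fintype_le _ _).trans ?_
      have : ∀ k, volume (Metric.ball (y k) σ) = volume (Metric.ball (0 : V3) σ) := fun k => by
        rw [EuclideanSpace.volume_ball_fin_three, EuclideanSpace.volume_ball_fin_three]
      simp [this]
    calc volume (cellCube L) - (m + 1 : ℕ) * volume (Metric.ball (0 : V3) σ)
        ≤ volume (cellCube L) - volume (⋃ k, Metric.ball (y k) σ) := tsub_le_tsub_left hballs _
      _ ≤ volume G := by
          refine tsub_le_iff_right.2 ((measure_mono hcover).trans (measure_union_le _ _))
  · exact measure_mono fun z hz => hz.1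

/-- **Mass bounds**: `Z_{m+1} (vol[0,L]³ − (m+1) vol B(0,σ)) ≤ Z_{m+2} ≤ Z_{m+1} vol[0,L]³`. [folklore] -/
theorem posZ_succ_bounds (σ L : ℝ) (m : ℕ) :
    posZ σ L (m + 1) * (volume (cellCube L) - (m + 1 : ℕ) * volume (Metric.ball (0 : V3) σ)) ≤ posZ σ L (m + 2) ∧
      posZ σ L (m + 2) ≤ posZ σ L (m + 1) * volume (cellCube L) := by
  have hadm := measurableSet_posAdmissible σ L (m + 1)
  have hind : ∀ y : Fin (m + 1) → V3,
      volume {q : V3 | Fin.cons (y 0 - q) y ∈ posAdmissible σ L (m + 2)} =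
        (posAdmissible σ L (m + 1)).indicator
          (fun y => volume {q : V3 | Fin.cons (y 0 - q) y ∈ posAdmissible σ L (m + 2)}) y := by
    intro y
    by_cases hy : y ∈ posAdmissible σ L (m + 1)
    · rw [Set.indicator_of_mem hy]
    · rw [Set.indicator_of_notMem hy]
      have : {q : V3 | Fin.cons (y 0 - q) y ∈ posAdmissible σ L (m + 2)} = ∅ :=
        Set.eq_empty_of_forall_notMem fun q hq => hy ((insertGhost_mem_posAdmissible_iff σ L y q).1 hq).1
      rw [this, measure_empty]
  rw [posZ_succ_eq_lintegral, lintegral_congr hind, lintegral_indicator hadm]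
  constructor
  · calc posZ σ L (m + 1) * (volume (cellCube L) - (m + 1 : ℕ) * volume (Metric.ball (0 : V3) σ))
        = ∫⁻ _y in posAdmissible σ L (m + 1),
            (volume (cellCube L) - (m + 1 : ℕ) * volume (Metric.ball (0 : V3) σ)) := by
          rw [setLIntegral_const, mul_comm]; rfl
      _ ≤ _ := setLIntegral_mono' hadm fun y hy => (volume_ghostFits_bounds σ L hy).1
  · calc ∫⁻ y in posAdmissible σ L (m + 1), volume {q : V3 | Fin.cons (y 0 - q) y ∈ posAdmissible σ L (m + 2)}
        ≤ ∫⁻ _y in posAdmissible σ L (m + 1), volume (cellCube L) :=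
          setLIntegral_mono' hadm fun y hy => (volume_ghostFits_bounds σ L hy).2
      _ = posZ σ L (m + 1) * volume (cellCube L) := by rw [setLIntegral_const, mul_comm]; rfl

/-! ## § 4 The registered sub-goal -/

/-- **Registered sub-goal `stub_contactStatistics_ghost`** (piece of stub `stub_contactStatistics`, S2c, of the line
`enskog-compensator-martingale`): the ghost-sphere representation of the pair law of the cell — (i) the ghost-fitting
event implies admissibility of the real centres; (ii) for every measurable `ψ`,
`∫ ψ(x₁ − x₀) dposLaw_{m+2} = (Z_{m+1}/Z_{m+2}) ∫ ψ(q) · posLaw_{m+1}{(y₀ − q, y) admissible} dq`; (iii) the mass bounds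
`Z_{m+1}(vol[0,L]³ − (m+1) vol B(0,σ)) ≤ Z_{m+2} ≤ Z_{m+1} vol[0,L]³`. [cite: Ruelle1969, §4.2] -/
theorem stub_contactStatistics_ghost : ∀ (σ L : ℝ) (m : ℕ),
    (∀ q : V3, {y : Fin (m + 1) → V3 | Fin.cons (y 0 - q) y ∈ posAdmissible σ L (m + 2)} ⊆ posAdmissible σ L (m + 1)) ∧
    (posZ σ L (m + 1) ≠ 0 → ∀ ψ : V3 → ℝ, Measurable ψ →
      ∫ x, ψ (x 1 - x 0) ∂(posLaw σ L (m + 2)) =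
        ((posZ σ L (m + 2))⁻¹ * posZ σ L (m + 1)).toReal *
          ∫ q, ψ q * (posLaw σ L (m + 1)).real {y | Fin.cons (y 0 - q) y ∈ posAdmissible σ L (m + 2)}) ∧
    (posZ σ L (m + 1) * (volume {x : V3 | ∀ k, x k ∈ Set.Icc (0 : ℝ) L} -
        (m + 1 : ℕ) * volume (Metric.ball (0 : V3) σ)) ≤ posZ σ L (m + 2) ∧
      posZ σ L (m + 2) ≤ posZ σ L (m + 1) * volume {x : V3 | ∀ k, x k ∈ Set.Icc (0 : ℝ) L}) :=
  fun σ L m => ⟨insertGhost_subset_posAdmissible σ L m, fun h0 _ hψ => integral_pairDiff_posLaw σ L m h0 hψ,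
    posZ_succ_bounds σ L m⟩

end Summit.AtomisticToContinuum.HydrodynamicLimit.Theorems.EnskogCompensator

end
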